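import Literature.NumberTheory.CubicFields.UniformityOverringStep
import Literature.NumberTheory.CubicFields.UniformityEstimate
import HarnessLib

/-!
# BTT 2023 Prop. 4.5 (`q² ∣ Disc`, `6^{ω(q)}`) from its maximal part: the induction over the primes of `q`

`Proofs` file (theorems only: no definitions, no named facts). Topic `Literature/NumberTheory/CubicFields`;
continues `UniformityOverringStep.lean` (the orbit families `maxOrbits B s Y m`, the overring step
`ncard_nonmaxOrbits_le`, the factor `stepFactor c p = c + 3 + 1/p² + (p+1)/p⁴`, the predicate
`MaximalPartBound c C`) towards the named fact `btt_uniformity_sqDvd` of `UniformityEstimate.lean`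
(Bhargava–Taniguchi–Thorne 2023, Prop. 4.5: `#{R : q² ∣ Disc R, 0 < ±Disc R < X} ≪ 6^{ω(q)} X/q²`).

Bhargava–Taniguchi–Thorne 2023, §4.2: Prop. 4.5 is "a variation of [DH] and [BBP]" and Prop. 4.6 (the
rings nonmaximal at `q`, `3^{ω(q)}`) "can be proved in essentially the same way as [BBP]". The proof has
an algebraic half — Lemma 2.3: overrings of index `p` and at most `3` (resp. `p + 1`) subrings of index
`p`, which turns "nonmaximal at `p`" into a factor `(3 + O(p⁻²))/p²` (BST Prop. 23) — and an analytic
half: the count of the orbits MAXIMAL at the primes in question with `p² ∣ Disc` (totally ramified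
primes), by reduction theory [DH, §5], [BBP, §3]. This file proves the algebraic half completely, as an
implication from the analytic half in the shape `MaximalPartBound c C`:

* `ncard_maxOrbits_le_of_maximalPartBound` — **the induction**: for disjoint finite sets of primes `A`
  (no condition) and `B` (maximal), `m = ∏A·∏B`, `0 ≤ Y`:
  `#maxOrbits B s Y m ≤ 2C · c^{#B} · ∏_{p ∈ A} (c + 3 + 1/p² + (p+1)/p⁴) · Y/m²`
  (split at `p ∈ A` into maximal at `p` — induction with `B ∪ {p}` — and nonmaximal at `p` — the
  overring step and induction at `Y/p²`, `Y/p⁶`, `Y/p⁴`);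
* `ncard_maxOrbits_empty` — `#maxOrbits ∅ s X q = Σ_{0 < s·D < X, q² ∣ D} h(D)`, the sum of Prop. 4.5;
* `sum_classNumber_le_of_maximalPartBound` — hence `Σ ≤ 2C ∏_{p ∣ q} (c + 3 + 1/p² + (p+1)/p⁴) X/q²`;
* **`btt_uniformity_sqDvd_of_maximalPartBound`** — with `c ≤ 2` every factor is `≤ 6`:
  **`MaximalPartBound c C → btt_uniformity_sqDvd`**;
* `maximalPartBound_of_btt_uniformity_sqDvd` — conversely Prop. 4.5 contains `MaximalPartBound 6 C`
  (so the hypothesis is a genuine fragment of the printed theorem; what remains open in the tree is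
  the reduction-theoretic count of the maximal, totally ramified part with a constant `c ≤ 2` per prime).

## References

* M. Bhargava, T. Taniguchi, F. Thorne, *Improved error estimates for the Davenport–Heilbronn
  theorems*, Math. Ann. 389 (2024) = arXiv:2107.12819, Lemma 2.3, §4.2 Props. 4.5–4.6 [BhargavaTaniguchiThorne2023].
* M. Bhargava, A. Shankar, J. Tsimerman, *On the Davenport–Heilbronn theorems and second order
  terms*, Invent. Math. 193 (2013) 439–499, Prop. 23 [BhargavaShankarTsimerman2012].
* K. Belabas, M. Bhargava, C. Pomerance, *Error estimates for the Davenport–Heilbronn theorems*,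
  Duke Math. J. 153 (2010) 173–210 [BelabasBhargavaPomerance2010].
* H. Davenport, H. Heilbronn, *On the density of discriminants of cubic fields. II*, Proc. Roy.
  Soc. London A 322 (1971) 405–420 [DavenportHeilbronn1971].
-/

noncomputable section

namespace Literature.NumberTheory.CubicFields

open BinaryCubic RingOfForm

/-! ### The induction over the primes of `q` -/

section Reduction

/-- `stepFactor c p ≥ 0` for `c ≥ 0`. [folklore] -/
theorem stepFactor_nonneg {c : ℝ} (hc : 0 ≤ c) (p : ℕ) : 0 ≤ stepFactor c p := by
  unfold stepFactor; positivity

/-- `stepFactor c p ≤ 6` for `c ≤ 2` and `p ≥ 2` (`1/p² ≤ 1/4`, `(p+1)/p⁴ ≤ 1/4`). [folklore] -/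
theorem stepFactor_le_six {c : ℝ} (hc2 : c ≤ 2) {p : ℕ} (hp : 2 ≤ p) : stepFactor c p ≤ 6 := by
  unfold stepFactor
  have hp' : (2 : ℝ) ≤ p := by exact_mod_cast hp
  have h1 : 1 / (p : ℝ) ^ 2 ≤ 1 / 4 := by
    apply one_div_le_one_div_of_le (by norm_num); nlinarith
  have h2 : ((p : ℝ) + 1) / (p : ℝ) ^ 4 ≤ 1 / 4 := by
    rw [div_le_iff₀ (by positivity)]
    have h4 : (4 : ℝ) ≤ (p : ℝ) * p := by nlinarith
    have h16 : (4 : ℝ) * 4 ≤ ((p : ℝ) * p) * ((p : ℝ) * p) := by nlinarith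
    have : (p : ℝ) ^ 4 = ((p : ℝ) * p) * ((p : ℝ) * p) := by ring
    rw [this]; nlinarith
  linarith

/-- The family grows with the window. [folklore] -/
theorem maxOrbits_mono {B : Finset ℕ} {s : ℤ} {m : ℕ} {Y Y' : ℝ} (h : Y ≤ Y') : maxOrbits B s Y m ⊆ maxOrbits B s Y' m :=
  fun _ ⟨f, hO, ⟨h0, hY⟩, hm, hB⟩ => ⟨f, hO, ⟨h0, hY.trans_le h⟩, hm, hB⟩

/-- Below `Y = 1` the family is empty (`s·Disc` is a positive integer). [folklore] -/
theorem maxOrbits_eq_empty_of_lt_one {B : Finset ℕ} {s : ℤ} {m : ℕ} {Y : ℝ} (hY : Y < 1) : maxOrbits B s Y m = ∅ := by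
  ext O
  simp only [Set.mem_empty_iff_false, iff_false]
  rintro ⟨f, -, ⟨h0, hY'⟩, -⟩
  have : (1 : ℝ) ≤ ((s * f.disc : ℤ) : ℝ) := by exact_mod_cast h0
  linarith

/-- The constant of a maximal-part bound is nonnegative (test it on `B = ∅`, `X = 1`). [folklore] -/
theorem MaximalPartBound.nonneg {c C : ℝ} (h : MaximalPartBound c C) : 0 ≤ C := by
  have := h ∅ (by simp) 1 (Or.inl rfl) 1
  simp only [Finset.card_empty, pow_zero, mul_one, Nat.cast_one, Finset.prod_empty, one_pow, div_one] at this
  exact (Nat.cast_nonneg _).trans this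

/-- The hypothesis at real `Y ≥ 0`, at the cost of a factor `2` (`⌈Y⌉₊ ≤ 2Y` for `Y ≥ 1`, empty below `1`). [folklore] -/
theorem ncard_maxOrbits_le_base {c C : ℝ} (hc : 0 ≤ c) (h : MaximalPartBound c C) {B : Finset ℕ}
    (hB : ∀ ℓ ∈ B, ℓ.Prime) {s : ℤ} (hs : s = 1 ∨ s = -1) {Y : ℝ} (hY : 0 ≤ Y) :
    ((maxOrbits B s Y (∏ ℓ ∈ B, ℓ)).ncard : ℝ) ≤ 2 * C * c ^ B.card * Y / ((∏ ℓ ∈ B, ℓ : ℕ) : ℝ) ^ 2 := by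
  have hC := h.nonneg
  rcases lt_or_ge Y 1 with hY1 | hY1
  · rw [maxOrbits_eq_empty_of_lt_one hY1, Set.ncard_empty, Nat.cast_zero]; positivity
  · have h1 : ((maxOrbits B s Y (∏ ℓ ∈ B, ℓ)).ncard : ℝ) ≤ (maxOrbits B s (⌈Y⌉₊ : ℕ) (∏ ℓ ∈ B, ℓ)).ncard := by
      exact_mod_cast Set.ncard_le_ncard (maxOrbits_mono (Nat.le_ceil Y)) (maxOrbits_finite _ _ _ _)
    have h3 : ((⌈Y⌉₊ : ℕ) : ℝ) ≤ 2 * Y := by linarith [Nat.ceil_lt_add_one hY]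
    refine (h1.trans (h B hB s hs ⌈Y⌉₊)).trans (div_le_div_of_nonneg_right ?_ (by positivity))
    calc C * c ^ B.card * ((⌈Y⌉₊ : ℕ) : ℝ) ≤ C * c ^ B.card * (2 * Y) := mul_le_mul_of_nonneg_left h3 (by positivity)
      _ = 2 * C * c ^ B.card * Y := by ring

/-- **The induction over the primes of `q`** (BTT Props. 4.5–4.6, proof scheme of [BBP]/[BST]): under a
maximal-part bound `(c, C)`, for disjoint finite sets of primes `A` (where nothing is imposed) and `B`
(maximality imposed), `m = ∏A · ∏B`, the orbits with `0 < s·Disc < Y`, `m² ∣ Disc`, maximal at `B` number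
at most `2C · c^{#B} · ∏_{p ∈ A} (c + 3 + 1/p² + (p+1)/p⁴) · Y / m²`. [folklore] -/
theorem ncard_maxOrbits_le_of_maximalPartBound {c C : ℝ} (hc : 0 ≤ c) (h : MaximalPartBound c C)
    {s : ℤ} (hs : s = 1 ∨ s = -1) (A : Finset ℕ) :
    ∀ B : Finset ℕ, (∀ p ∈ A, p.Prime) → (∀ ℓ ∈ B, ℓ.Prime) → Disjoint A B →
      ∀ m : ℕ, m = (∏ p ∈ A, p) * ∏ ℓ ∈ B, ℓ → ∀ Y : ℝ, 0 ≤ Y →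
        ((maxOrbits B s Y m).ncard : ℝ) ≤
          2 * C * c ^ B.card * (∏ p ∈ A, stepFactor c p) * Y / (m : ℝ) ^ 2 := by
  have hC := h.nonneg
  induction A using Finset.induction_on with
  | empty =>
    intro B _ hB _ m hm Y hY
    rw [Finset.prod_empty, one_mul] at hm
    subst hm
    rw [Finset.prod_empty, mul_one]
    exact ncard_maxOrbits_le_base hc h hB hs hY
  | insert p A' hpA ih =>
    intro B hA hB hAB m hm Y hY
    have hp : p.Prime := hA p (Finset.mem_insert_self _ _)
    have hA' : ∀ q ∈ A', q.Prime := fun q hq => hA q (Finset.mem_insert_of_mem hq)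
    have hpB : p ∉ B := Finset.disjoint_left.mp hAB (Finset.mem_insert_self _ _)
    have hA'B : Disjoint A' B := Finset.disjoint_of_subset_left (Finset.subset_insert _ _) hAB
    haveI : Fact p.Prime := ⟨hp⟩
    -- the modulus `m = p · m'`
    set m' : ℕ := (∏ q ∈ A', q) * ∏ ℓ ∈ B, ℓ with hm'
    have hmpm : m = p * m' := by rw [hm, Finset.prod_insert hpA]; ring
    have hm'0 : m' ≠ 0 := by
      rw [hm']
      exact mul_ne_zero (Finset.prod_ne_zero_iff.mpr fun q hq => (hA' q hq).ne_zero)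
        (Finset.prod_ne_zero_iff.mpr fun ℓ hℓ => (hB ℓ hℓ).ne_zero)
    have hpm' : p.Coprime m' := by
      rw [hm']
      refine Nat.Coprime.mul_right (Nat.coprime_prod_right_iff.mpr fun q hq => ?_)
        (Nat.coprime_prod_right_iff.mpr fun ℓ hℓ => ?_)
      · exact (Nat.coprime_primes hp (hA' q hq)).mpr (fun h => hpA (h ▸ hq))
      · exact (Nat.coprime_primes hp (hB ℓ hℓ)).mpr (fun h => hpB (h ▸ hℓ))
    -- term 1: maximal at `p`, induction hypothesis with `insert p B`
    have hB' : ∀ ℓ ∈ insert p B, ℓ.Prime := by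
      intro ℓ hℓ
      rcases Finset.mem_insert.mp hℓ with rfl | hℓ
      exacts [hp, hB ℓ hℓ]
    have hm1 : m = (∏ q ∈ A', q) * ∏ ℓ ∈ insert p B, ℓ := by rw [Finset.prod_insert hpB, hmpm, hm']; ring
    have e1 := ih (insert p B) hA' hB' (Finset.disjoint_insert_right.mpr ⟨hpA, hA'B⟩) m hm1 Y hY
    rw [Finset.card_insert_of_notMem hpB, hmpm] at e1
    -- term 2: nonmaximal at `p`, the overring step and the induction hypothesis thrice
    have hstep : ((nonmaxOrbits B s Y (p * m') p).ncard : ℝ) ≤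
        3 * (maxOrbits B s (Y / (p : ℝ) ^ 2) m').ncard + ((p : ℝ) + 1) * (maxOrbits B s (Y / (p : ℝ) ^ 6) m').ncard +
          (maxOrbits B s (Y / (p : ℝ) ^ 4) m').ncard := by
      exact_mod_cast ncard_nonmaxOrbits_le p hB hpm'
    have e2 := ih B hA' hB hA'B m' rfl (Y / (p : ℝ) ^ 2) (by positivity)
    have e6 := ih B hA' hB hA'B m' rfl (Y / (p : ℝ) ^ 6) (by positivity)
    have e4 := ih B hA' hB hA'B m' rfl (Y / (p : ℝ) ^ 4) (by positivity)
    have hsplit : ((maxOrbits B s Y (p * m')).ncard : ℝ) =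
        (maxOrbits (insert p B) s Y (p * m')).ncard + (nonmaxOrbits B s Y (p * m') p).ncard := by
      exact_mod_cast ncard_maxOrbits_eq_add B s Y (p * m') p
    rw [hmpm, hsplit, Finset.prod_insert hpA]
    -- assemble
    set K : ℝ := 2 * C * c ^ B.card * ∏ q ∈ A', stepFactor c q with hK
    have hK0 : 0 ≤ K := by
      rw [hK]; exact mul_nonneg (by positivity) (Finset.prod_nonneg fun q _ => stepFactor_nonneg hc q)
    have hp0 : (0 : ℝ) < p := by exact_mod_cast hp.pos
    have hm0 : (0 : ℝ) < m' := by exact_mod_cast Nat.pos_of_ne_zero hm'0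
    have key : K * c * Y / ((p * m' : ℕ) : ℝ) ^ 2 +
        (3 * (K * (Y / (p : ℝ) ^ 2) / (m' : ℝ) ^ 2) + ((p : ℝ) + 1) * (K * (Y / (p : ℝ) ^ 6) / (m' : ℝ) ^ 2) +
          K * (Y / (p : ℝ) ^ 4) / (m' : ℝ) ^ 2) =
        2 * C * c ^ B.card * (stepFactor c p * ∏ q ∈ A', stepFactor c q) * Y / ((p * m' : ℕ) : ℝ) ^ 2 := by
      rw [hK, stepFactor]
      push_cast
      field_simp
      ring
    have e1' : ((maxOrbits (insert p B) s Y (p * m')).ncard : ℝ) ≤ K * c * Y / ((p * m' : ℕ) : ℝ) ^ 2 := by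
      convert e1 using 2; rw [hK]; ring
    have e2' : ((maxOrbits B s (Y / (p : ℝ) ^ 2) m').ncard : ℝ) ≤ K * (Y / (p : ℝ) ^ 2) / (m' : ℝ) ^ 2 := by
      convert e2 using 2
    have e6' : ((maxOrbits B s (Y / (p : ℝ) ^ 6) m').ncard : ℝ) ≤ K * (Y / (p : ℝ) ^ 6) / (m' : ℝ) ^ 2 := by
      convert e6 using 2
    have e4' : ((maxOrbits B s (Y / (p : ℝ) ^ 4) m').ncard : ℝ) ≤ K * (Y / (p : ℝ) ^ 4) / (m' : ℝ) ^ 2 := by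
      convert e4 using 2
    rw [← key]
    refine add_le_add e1' (hstep.trans ?_)
    exact add_le_add (add_le_add (mul_le_mul_of_nonneg_left e2' (by norm_num))
      (mul_le_mul_of_nonneg_left e6' (by positivity))) e4'

end Reduction

/-! ### Back to `Σ_D h(D)`: BTT Prop. 4.5 from the maximal part, and conversely -/

section Final

/-- Distinct discriminants have disjoint sets of orbits. [folklore] -/
theorem disjoint_orbitsOfDisc {D D' : ℤ} (h : D ≠ D') : Disjoint (orbitsOfDisc D) (orbitsOfDisc D') := by
  rw [Set.disjoint_left]
  rintro O ⟨f, rfl, hf⟩ ⟨f', hff', hf'⟩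
  exact h (hf.symm.trans ((gl2zOrbit_eq_iff.mp hff').disc_eq.symm.trans hf'))

/-- `#(⋃_{D ∈ F} orbitsOfDisc D) = Σ_{D ∈ F} h(D)` for a finite set `F` of nonzero discriminants. [folklore] -/
theorem ncard_biUnion_orbitsOfDisc (F : Finset ℤ) (hF : ∀ D ∈ F, D ≠ 0) :
    (⋃ D ∈ F, orbitsOfDisc D).ncard = ∑ D ∈ F, classNumber D := by
  classical
  induction F using Finset.induction_on with
  | empty => simp
  | insert D F hDF ih =>
    have hD : D ≠ 0 := hF D (Finset.mem_insert_self _ _)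
    have hF' : ∀ D' ∈ F, D' ≠ 0 := fun D' hD' => hF D' (Finset.mem_insert_of_mem hD')
    rw [Finset.set_biUnion_insert, Finset.sum_insert hDF, ← ih hF', classNumber, Nat.card_coe_set_eq]
    refine Set.ncard_union_eq ?_ (orbitsOfDisc_finite hD)
      (F.finite_toSet.biUnion fun D' hD' => orbitsOfDisc_finite (hF' D' hD'))
    rw [Set.disjoint_iUnion₂_right]
    exact fun D' hD' => disjoint_orbitsOfDisc (fun h => hDF (h ▸ hD'))

/-- For `B = ∅` the family is the union of the `orbitsOfDisc D` over the window with `q² ∣ D`. [folklore] -/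
theorem maxOrbits_empty_eq_biUnion {s : ℤ} (hs : s = 1 ∨ s = -1) (X q : ℕ) :
    maxOrbits ∅ s X q = ⋃ D ∈ (discWindow s X).filter (fun D => ((q : ℕ) : ℤ) ^ 2 ∣ D), orbitsOfDisc D := by
  ext O
  constructor
  · rintro ⟨f, rfl, ⟨h0, hX⟩, hq, -⟩
    exact Set.mem_iUnion₂.mpr ⟨f.disc, Finset.mem_filter.mpr ⟨(mem_discWindow hs).mpr ⟨h0, by exact_mod_cast hX⟩, hq⟩,
      f, rfl, rfl⟩
  · intro hO
    obtain ⟨D, hD, f, rfl, rfl⟩ := Set.mem_iUnion₂.mp hO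
    obtain ⟨hw, hq⟩ := Finset.mem_filter.mp hD
    obtain ⟨h0, hX⟩ := (mem_discWindow hs).mp hw
    exact ⟨f, rfl, ⟨h0, by exact_mod_cast hX⟩, hq, fun ℓ hℓ => absurd hℓ (Finset.notMem_empty ℓ)⟩

/-- **`#maxOrbits ∅ s X q = Σ_{0 < s·D < X, q² ∣ D} h(D)`**, the sum of BTT Prop. 4.5. [folklore] -/
theorem ncard_maxOrbits_empty {s : ℤ} (hs : s = 1 ∨ s = -1) (X q : ℕ) :
    (maxOrbits ∅ s X q).ncard = ∑ D ∈ (discWindow s X).filter (fun D => ((q : ℕ) : ℤ) ^ 2 ∣ D), classNumber D := by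
  rw [maxOrbits_empty_eq_biUnion hs X q]
  refine ncard_biUnion_orbitsOfDisc _ fun D hD => ?_
  obtain ⟨h0, -⟩ := (mem_discWindow hs).mp (Finset.mem_filter.mp hD).1
  rintro rfl
  rw [mul_zero] at h0
  exact lt_irrefl _ h0

/-- **The uniformity sum under a maximal-part bound `(c, C)`**: for squarefree `q`,
`Σ_{0 < s·D < X, q² ∣ D} h(D) ≤ 2C · ∏_{p ∣ q} (c + 3 + 1/p² + (p+1)/p⁴) · X / q²`. [folklore] -/
theorem sum_classNumber_le_of_maximalPartBound {c C : ℝ} (hc : 0 ≤ c) (h : MaximalPartBound c C) {q : ℕ}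
    (hq : Squarefree q) {s : ℤ} (hs : s = 1 ∨ s = -1) (X : ℕ) :
    ((∑ D ∈ (discWindow s X).filter (fun D => ((q : ℕ) : ℤ) ^ 2 ∣ D), classNumber D : ℕ) : ℝ) ≤
      2 * C * (∏ p ∈ q.primeFactors, stepFactor c p) * X / (q : ℝ) ^ 2 := by
  have hmain := ncard_maxOrbits_le_of_maximalPartBound hc h hs q.primeFactors ∅
    (fun p hp => Nat.prime_of_mem_primeFactors hp) (by simp) (Finset.disjoint_empty_right _) q
    (by rw [Finset.prod_empty, mul_one, Nat.prod_primeFactors_of_squarefree hq]) X (Nat.cast_nonneg X)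
  rw [ncard_maxOrbits_empty hs X q] at hmain
  simpa only [Finset.card_empty, pow_zero, mul_one] using hmain

/-- **BTT 2023, Prop. 4.5 from the maximal part**: a maximal-part bound with `c ≤ 2` gives
`Σ_{0 < ±D < X, q² ∣ D} h(D) ≤ 2C · 6^{ω(q)} X/q²` for all squarefree `q` (each prime contributes
`c + 3 + 1/p² + (p+1)/p⁴ ≤ 6`). [folklore] -/
theorem btt_uniformity_sqDvd_of_maximalPartBound {c C : ℝ} (hc : 0 ≤ c) (hc2 : c ≤ 2) (h : MaximalPartBound c C) :
    btt_uniformity_sqDvd := by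
  refine ⟨2 * C, fun q hq s hs X => (sum_classNumber_le_of_maximalPartBound hc h hq hs X).trans ?_⟩
  have hC := h.nonneg
  have hF : ∏ p ∈ q.primeFactors, stepFactor c p ≤ (6 : ℝ) ^ q.primeFactors.card := by
    rw [← Finset.prod_const]
    exact Finset.prod_le_prod (fun p _ => stepFactor_nonneg hc p)
      (fun p hp => stepFactor_le_six hc2 (Nat.prime_of_mem_primeFactors hp).two_le)
  have hX : (0 : ℝ) ≤ (X : ℝ) / (q : ℝ) ^ 2 := by positivity
  calc 2 * C * (∏ p ∈ q.primeFactors, stepFactor c p) * X / (q : ℝ) ^ 2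
      = 2 * C * (∏ p ∈ q.primeFactors, stepFactor c p) * (X / (q : ℝ) ^ 2) := by ring
    _ ≤ 2 * C * (6 : ℝ) ^ q.primeFactors.card * (X / (q : ℝ) ^ 2) :=
        mul_le_mul_of_nonneg_right (mul_le_mul_of_nonneg_left hF (by positivity)) hX
    _ = 2 * C * 6 ^ q.primeFactors.card * X / (q : ℝ) ^ 2 := by ring

/-- **Conversely, BTT Prop. 4.5 contains the maximal part with `c = 6`** (drop the maximality
conditions; `∏ B` is squarefree with `ω = #B`). [folklore] -/
theorem maximalPartBound_of_btt_uniformity_sqDvd (h : btt_uniformity_sqDvd) : ∃ C : ℝ, MaximalPartBound 6 C := by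
  obtain ⟨C, hC⟩ := h
  refine ⟨C, fun B hB s hs X => ?_⟩
  have hsq : Squarefree (∏ ℓ ∈ B, ℓ) := by
    refine Finset.squarefree_prod_of_pairwise_isCoprime (fun ℓ hℓ ℓ' hℓ' hne => ?_)
      fun ℓ hℓ => (hB ℓ hℓ).prime.squarefree
    exact Nat.coprime_iff_isRelPrime.mp ((Nat.coprime_primes (hB ℓ hℓ) (hB ℓ' hℓ')).mpr hne)
  have hsub : maxOrbits B s X (∏ ℓ ∈ B, ℓ) ⊆ maxOrbits ∅ s X (∏ ℓ ∈ B, ℓ) :=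
    fun _ ⟨f, hO, hw, hm, _⟩ => ⟨f, hO, hw, hm, fun ℓ hℓ => absurd hℓ (Finset.notMem_empty ℓ)⟩
  have h1 : ((maxOrbits B s X (∏ ℓ ∈ B, ℓ)).ncard : ℝ) ≤ (maxOrbits ∅ s X (∏ ℓ ∈ B, ℓ)).ncard := by
    exact_mod_cast Set.ncard_le_ncard hsub (maxOrbits_finite _ _ _ _)
  have hcard : B.card = (∏ ℓ ∈ B, ℓ).primeFactors.card := by rw [Nat.primeFactors_prod hB]
  refine h1.trans ?_
  rw [ncard_maxOrbits_empty hs X, hcard]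
  exact hC _ hsq s hs X

end Final

end Literature.NumberTheory.CubicFields

end
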